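import Summits.QuantumFields.BalabanUV.T4Continuum.Support.BoundaryRateLayeredWord

/-!
# BoundaryRateLayeredWordShapes (part 2 of 3 of the layered word frame) — the frame shapes (F-Ch)/(F-Co)/(F-G), (F-M)/(F-E) OF THE
LAYERED LETTER CORES from the fit and the SHARPNESS of the fit, the layered HOOK ((F-P), `MarginCauchy` with `c₀ = 2` through
`T4BoundaryRateFrame.framePath_of_convexCore`), and `CollarDecay` of the layer-weighted chart (tree target
`Summits/QuantumFields/BalabanUV/T4Continuum/Support/`; cell `pub-balaban`, spine estimate NE5, boundary-functional member, lineage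
t4-ne5-p3 gen 13; imports part 1 `BoundaryRateLayeredWord` ONLY — read ITS module docstring for the HONEST FRAMING, the print
CONTEXT and the ABSOLUTE RULE, which govern this part verbatim; [folklore], 0 sorry, every located input a binder.)

HONEST FRAMING (short form; part 1 in full).  Rung (B)+1 bookkeeping on a FIXED finite torus — NOT infinite volume, NOT a mass gap,
NOT Clay.  `T4BoundaryCarrier.NE5B` is NOT PRINTED and is not re-filed, re-worded or weakened here.  THIS IS A TOY on layered words in
non-commuting letters over an arbitrary complex normed algebra; it encodes NOTHING of Bałaban's spaces (2.34)–(2.39) ([III] p. 261)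
and claims nothing about them.  NOT summit progress.

CONTENT [folklore].  §(c) `lw_frameChart` (rfl), `lw_frameCore`, `lw_frameGauge`, `lwcore_convex`, `lw_layer_le_gap`,
`lw_core_frameMargin` ((F-M) of `withDom (lwFrame …) (lwcore 𝔸 k N ℓ)` from `LWordFits`), `sum_norm_layer_disp`,
`lw_core_frameEndMargin` ((F-E) from the fit), the SHARPNESS `lw_core_frameEndMargin_iff` ((F-E) of the layered cores ⟺ the fit;
at least one letter, positive core radii, non-negative rooms), the admissible class `LwAdmT` ((F-An) on the layered word domains),
`lw_frameAnalytic`, `isLinearMap_single_layer`; §(d) THE HOOK, LAYERED: `lwcore_subset_dom` (§13k's `wordCore_subset_wordDom` layer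
by layer), `lw_framePath` ((F-P) for the ORIGINAL layered frame via `framePath_of_convexCore`), `lw_marginCauchy` (`MarginCauchy … 2`
via `marginCauchy_of_convexCore`); §(e) `lw_dist_chart`, `lw_collarDecay_rescale` (units `υ ≤ S·ω` ⇒ `CollarDecay` with `ε = S·s`
in the `ω`-rescaled gauge), `lw_collarDecay`, `lwPrinted_collarDecay` (`υ m = a·α m` ⇒ `ε = a·s` in the `α`-rescaled gauge).

ABSOLUTE RULE.  [folklore] kernel mathematics only; no `sorry`, no axiom beyond the standard triple, no hypothesis of statement type;
print appears in docstrings as CONTEXT only ([I] = [Balaban1987RG1] p. 273 *"We assume also that ε₁ is so small that 𝐇_j(B(t))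
satisfies (3.14) with 1/3α₂ on the right-hand side."*; [III] = [Balaban1988Convergent] p. 277 *"The analyticity domains become
smaller after each step, but the difference is very small and exponentially decreasing in the number of steps."* — spans certified
in the lineage's cross-reads of the Frame and Word leaves); nothing of Bałaban's run is derived from print.  Cell record
`t4/T4-EST-U3-NE5B-P3.md` §18.
[cite: Balaban1988Convergent, (2.34) p.261, (2.41) p.261, p.277; Balaban1987RG1, (3.4) p.270, (3.14)–(3.17) p.272–273]
-/

namespace Summit.QuantumFields.BalabanUV.T4Continuum.BoundaryRateLayeredWord

open Finset NormedSpace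
open Literature.MathematicalPhysics.QuantumFieldTheory.Balaban1983to89
open B7Prop6Bound T4OutputRate T4BoundaryCarrier T4BoundaryRate T4BoundaryRateCollar T4BoundaryRateFrame T4BoundaryRateWord

section LayeredFrame

variable {𝔸 : Type} [NormedRing 𝔸] [NormedAlgebra ℂ 𝔸]

/-! ### §(c) The frame shapes; (F-M), (F-E) OF THE LAYERED LETTER CORES from the fit, and the sharpness of the fit -/

/-- (F-Ch) ON THE LAYERED WORD FRAME [folklore]: the chart is the translation by the displacement (`rfl`). -/
theorem lw_frameChart (k N : ℕ) (υ : ℕ → ℝ) (δ : ℝ) (u : ℕ → ℕ → 𝔸) (r : ℕ → ℕ → ℝ) (c : ℕ → ℕ → ℝ) (s : ℝ) :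
    FrameChart (lwFrame k N υ δ u r) (lwChart 𝔸 k N c υ δ s) :=
  fun _ _ _ _ _ _ => rfl

/-- (F-Co) ON THE LAYERED WORD FRAME [folklore]: every background is an encoded point. -/
theorem lw_frameCore (k N : ℕ) (υ : ℕ → ℝ) (δ : ℝ) (u : ℕ → ℕ → 𝔸) (r : ℕ → ℕ → ℝ) (c : ℕ → ℕ → ℝ) (s : ℝ) :
    FrameCore (lwFrame k N υ δ u r) (lwChart 𝔸 k N c υ δ s) :=
  fun _ U _ => ⟨U.1, U.2, rfl⟩

/-- (F-G) ON THE LAYERED WORD FRAME [folklore]: the layer gauge of the translated layered word IS the layer letter sum of the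
displacement. -/
theorem lw_frameGauge (k N : ℕ) (υ : ℕ → ℝ) (δ : ℝ) (u : ℕ → ℕ → 𝔸) (r : ℕ → ℕ → ℝ) (c : ℕ → ℕ → ℝ) (s : ℝ) :
    FrameGauge (lwFrame k N υ δ u r) (lwChart 𝔸 k N c υ δ s) (lwGauge 𝔸 k N) := by
  intro X z i _ 𝒜 _ n
  show ∑ j, ‖((υ (lay N n) * cw δ X (lay N n)) • 𝒜) j‖ ≤
    ∑ j, ‖(z (lay N n) + (υ (lay N n) * cw δ X (lay N n)) • 𝒜) j - z (lay N n) j‖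
  simp

/-- THE LAYERED LETTER CORES ARE CONVEX [folklore] (`wcore_convex` layer by layer). -/
theorem lwcore_convex (k N : ℕ) (ℓ : ℕ → ℕ → ℝ) (Y : Fin (N + 1)) : Convex ℝ (lwcore 𝔸 k N ℓ Y) := by
  intro A hA B hB a b ha hb hab m hm
  have h := wcore_convex k (ℓ Y m) (hA m hm) (hB m hm) ha hb hab
  simpa using h

/-- The room constraint of (F-M)/(F-E) read on ONE layer `m ≤ Y` [folklore]: `Σ_i ‖w_{m,i}‖ ≤ gap X Y (Y − m)` (the constraint at
`j = Y − m`; `lay N m = m`). -/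
theorem lw_layer_le_gap {k N : ℕ} (υ : ℕ → ℝ) (δ : ℝ) (u : ℕ → ℕ → 𝔸) (r : ℕ → ℕ → ℝ)
    {gap : Fin (N + 1) → Fin (N + 1) → ℕ → ℝ} {X Y : Fin (N + 1)} {w : Fin (N + 1) → Fin k → 𝔸}
    (hw : ∀ j ∈ range ((lwCarriers 𝔸 k N).scale Y + 1), (lwFrame k N υ δ u r).semi ((lwCarriers 𝔸 k N).scale Y - j) w ≤ gap X Y j)
    (m : Fin (N + 1)) (hm : m ≤ Y) : ∑ i, ‖w m i‖ ≤ gap X Y ((Y : ℕ) - m) := by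
  have hmY : (m : ℕ) ≤ Y := hm
  have h := hw ((Y : ℕ) - m) (mem_range.mpr (by show (Y : ℕ) - m < (Y : ℕ) + 1; omega))
  have e : (lwCarriers 𝔸 k N).scale Y - ((Y : ℕ) - m) = (m : ℕ) := by show (Y : ℕ) - ((Y : ℕ) - m) = (m : ℕ); omega
  rw [e, lwFrame_semi_apply, lay_coe] at h
  exact h

/-- **(F-M) OF THE LAYERED LETTER CORES FROM THE STATIC HALF OF THE FIT** [folklore]: on every layer `m ≤ Y` a core word of the
step `X` (letter sum `< c X m`) plus a room vector (layer letter sum `≤ gap X Y (Y − m)`) has letter sum `< c X m + gap ≤ ℓ Y m`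
(`υ m·s·δ^{X−m} ≥ 0`). -/
theorem lw_core_frameMargin (k N : ℕ) {υ : ℕ → ℝ} {δ : ℝ} (u : ℕ → ℕ → 𝔸) (r : ℕ → ℕ → ℝ) {c : ℕ → ℕ → ℝ} {s : ℝ}
    {gap : Fin (N + 1) → Fin (N + 1) → ℕ → ℝ} {ℓ : ℕ → ℕ → ℝ} (hυ : ∀ m, 0 ≤ υ m) (hδ : 0 ≤ δ) (hs : 0 ≤ s)
    (hfit : LWordFits N c υ δ s gap ℓ) :
    FrameMargin (withDom (lwFrame k N υ δ u r) (lwcore 𝔸 k N ℓ)) (lwGeneration 𝔸 k N) (lwChart 𝔸 k N c υ δ s) gap := by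
  intro X Y hY z i hz w hw m hm
  have hYX : Y < X := (lw_mem_parents_iff X Y).1 hY
  have hz' : ∑ j, ‖z m j‖ < c X m := hz m (le_of_lt (lt_of_le_of_lt hm hYX))
  have hw' : ∑ j, ‖w m j‖ ≤ gap X Y ((Y : ℕ) - m) := lw_layer_le_gap υ δ u r hw m hm
  show ∑ j, ‖(z + w) m j‖ < ℓ Y m
  have hle : ∑ j, ‖(z + w) m j‖ ≤ ∑ j, ‖z m j‖ + ∑ j, ‖w m j‖ := by
    rw [← sum_add_distrib]; exact sum_le_sum fun j _ => norm_add_le _ _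
  have h0 : 0 ≤ υ m * s * δ ^ ((X : ℕ) - m) := by have := hυ m; positivity
  linarith [hfit X Y hYX m hm]

/-- The letter sum of the layer-`m` displacement: `Σ_i ‖(υ m·δ^{X−m})·𝒜_i‖ = υ m·δ^{X−m}·Σ_i ‖𝒜_i‖` for `m ≤ X` (`υ m, δ ≥ 0`).
[folklore] -/
theorem sum_norm_layer_disp {k : ℕ} {υ : ℕ → ℝ} {δ : ℝ} (hυ : ∀ m, 0 ≤ υ m) (hδ : 0 ≤ δ) {X m : ℕ} (hm : m ≤ X)
    (𝒜 : Fin k → 𝔸) : ∑ i, ‖((υ m * cw δ X m) • 𝒜) i‖ = υ m * δ ^ (X - m) * ∑ i, ‖𝒜 i‖ := by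
  rw [cw_of_le δ hm, mul_sum]
  refine sum_congr rfl fun i _ => ?_
  rw [Pi.smul_apply, norm_smul, Real.norm_of_nonneg (mul_nonneg (hυ m) (pow_nonneg hδ _))]

/-- **(F-E) OF THE LAYERED LETTER CORES FROM THE FIT** [folklore]: on every layer `m ≤ Y < X` the displaced core word
`z_m + (υ m·δ^{X−m})·𝒜` plus a room vector has letter sum `< c X m + υ m·s·δ^{X−m} + gap X Y (Y − m) ≤ ℓ Y m`. -/
theorem lw_core_frameEndMargin (k N : ℕ) {υ : ℕ → ℝ} {δ : ℝ} (u : ℕ → ℕ → 𝔸) (r : ℕ → ℕ → ℝ) {c : ℕ → ℕ → ℝ} {s : ℝ}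
    {gap : Fin (N + 1) → Fin (N + 1) → ℕ → ℝ} {ℓ : ℕ → ℕ → ℝ} (hυ : ∀ m, 0 ≤ υ m) (hδ : 0 ≤ δ)
    (hfit : LWordFits N c υ δ s gap ℓ) :
    FrameEndMargin (withDom (lwFrame k N υ δ u r) (lwcore 𝔸 k N ℓ)) (lwGeneration 𝔸 k N) (lwChart 𝔸 k N c υ δ s) gap := by
  intro X z i hz 𝒜 h𝒜 Y hY w hw m hm
  have hYX : Y < X := (lw_mem_parents_iff X Y).1 hY
  have hmX : (m : ℕ) ≤ X := le_of_lt (lt_of_le_of_lt (show (m : ℕ) ≤ Y from hm) (show (Y : ℕ) < X from hYX))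
  have hz' : ∑ j, ‖z m j‖ < c X m := hz m (le_of_lt (lt_of_le_of_lt hm hYX))
  have h𝒜' : ∑ j, ‖𝒜 j‖ ≤ s := h𝒜
  have hw' : ∑ j, ‖w m j‖ ≤ gap X Y ((Y : ℕ) - m) := lw_layer_le_gap υ δ u r hw m hm
  show ∑ j, ‖(z + (fun m' : Fin (N + 1) => (υ m' * cw δ X m') • 𝒜) + w) m j‖ < ℓ Y m
  have hd : ∑ j, ‖((υ m * cw δ X m) • 𝒜) j‖ ≤ υ m * s * δ ^ ((X : ℕ) - m) := by
    rw [sum_norm_layer_disp hυ hδ hmX]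
    have h0 : 0 ≤ υ m * δ ^ ((X : ℕ) - m) := mul_nonneg (hυ m) (pow_nonneg hδ _)
    nlinarith
  have hle : ∑ j, ‖(z + (fun m' : Fin (N + 1) => (υ m' * cw δ X m') • 𝒜) + w) m j‖ ≤
      ∑ j, ‖z m j‖ + ∑ j, ‖((υ m * cw δ X m) • 𝒜) j‖ + ∑ j, ‖w m j‖ := by
    rw [← sum_add_distrib, ← sum_add_distrib]
    exact sum_le_sum fun j _ => (norm_add_le _ _).trans (add_le_add (norm_add_le _ _) le_rfl)
  linarith [hfit X Y hYX m hm]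

/-- **SHARPNESS: (F-E) OF THE LAYERED LETTER CORES IS EXACTLY THE LAYERED FIT** [folklore] (at least one letter, `‖1‖ = 1`, positive
core radii, `υ, δ, s ≥ 0`, nonnegative rooms): test (F-E) on the one-layer words `(c X m − ε)·e₀` on the layer `m`, amplitude `s·e₀`,
room vector `gap X Y (Y − m)·e₀` on the layer `m`.  What the DEVICE costs on this toy is the layered fit and nothing less. -/
theorem lw_core_frameEndMargin_iff [NormOneClass 𝔸] {k : ℕ} (hk : 0 < k) (N : ℕ) (υ : ℕ → ℝ) (δ : ℝ) (u : ℕ → ℕ → 𝔸)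
    (r : ℕ → ℕ → ℝ) {c : ℕ → ℕ → ℝ} {s : ℝ} {gap : Fin (N + 1) → Fin (N + 1) → ℕ → ℝ} {ℓ : ℕ → ℕ → ℝ}
    (hc : ∀ j m, 0 < c j m) (hυ : ∀ m, 0 ≤ υ m) (hδ : 0 ≤ δ) (hs : 0 ≤ s) (hg : ∀ X Y j, 0 ≤ gap X Y j) :
    FrameEndMargin (withDom (lwFrame k N υ δ u r) (lwcore 𝔸 k N ℓ)) (lwGeneration 𝔸 k N) (lwChart 𝔸 k N c υ δ s) gap ↔
      LWordFits N c υ δ s gap ℓ := by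
  refine ⟨fun hE X Y hYX m hmY => le_of_not_gt fun hlt => ?_, lw_core_frameEndMargin k N u r hυ hδ⟩
  have hYX' : (Y : ℕ) < X := hYX
  have hmY' : (m : ℕ) ≤ Y := hmY
  have hmX : (m : ℕ) ≤ X := by omega
  set e : Fin k → 𝔸 := Pi.single ⟨0, hk⟩ 1 with he
  set D : ℝ := υ m * s * δ ^ ((X : ℕ) - m) with hD
  have hD0 : 0 ≤ D := by have := hυ m; positivity
  set G : ℝ := gap X Y ((Y : ℕ) - m) with hG
  have hG0 : 0 ≤ G := hg X Y _
  set ε : ℝ := min (c X m / 2) ((c X m + D + G - ℓ Y m) / 2) with hε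
  have hε0 : 0 < ε := lt_min (by linarith [hc X m]) (by linarith)
  have hεc : ε ≤ c X m / 2 := min_le_left _ _
  have hεd : ε ≤ (c X m + D + G - ℓ Y m) / 2 := min_le_right _ _
  set z : Fin (N + 1) → Fin k → 𝔸 := Pi.single m ((c X m - ε) • e) with hz
  have hzc : (lwFrame k N υ δ u r).pt z 0 ∈ (lwChart 𝔸 k N c υ δ s).core X := by
    intro m' hm'
    show ∑ i, ‖z m' i‖ < c X m'
    rw [hz, sum_norm_single_layer]
    by_cases hmm : m' = m
    · rw [if_pos hmm, he, sum_norm_smul_single hk, abs_of_nonneg (by linarith [hc X m]), hmm]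
      linarith
    · rw [if_neg hmm]; exact hc X m'
  have h𝒜 : s • e ∈ (lwChart 𝔸 k N c υ δ s).supp X := by
    show ∑ i, ‖(s • e) i‖ ≤ s
    rw [he, sum_norm_smul_single hk, abs_of_nonneg hs]
  set w : Fin (N + 1) → Fin k → 𝔸 := Pi.single m (G • e) with hw
  have hwr : ∀ j ∈ range ((lwCarriers 𝔸 k N).scale Y + 1),
      (withDom (lwFrame k N υ δ u r) (lwcore 𝔸 k N ℓ)).semi ((lwCarriers 𝔸 k N).scale Y - j) w ≤ gap X Y j := by
    intro j hj
    have hj' : j ≤ (Y : ℕ) := by have h1 := mem_range.mp hj; change j < (Y : ℕ) + 1 at h1; omega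
    show ∑ i, ‖w (lay N ((Y : ℕ) - j)) i‖ ≤ gap X Y j
    rw [hw, sum_norm_single_layer]
    by_cases hjm : lay N ((Y : ℕ) - j) = m
    · have hv : (m : ℕ) = (Y : ℕ) - j := by
        have h1 := congrArg Fin.val hjm
        rw [lay_val_of_le (by omega)] at h1
        exact h1.symm
      have hjY : j = (Y : ℕ) - m := by omega
      rw [if_pos hjm, he, sum_norm_smul_single hk, abs_of_nonneg hG0, hG, hjY]
    · rw [if_neg hjm]; exact hg X Y j
  have hmem := hE X z 0 hzc (s • e) h𝒜 Y ((lw_mem_parents_iff X Y).2 hYX) w hwr m hmY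
  have hsum : ∑ i, ‖(z + (fun m' : Fin (N + 1) => (υ m' * cw δ X m') • (s • e)) + w) m i‖ < ℓ Y m := hmem
  have hlay : (z + (fun m' : Fin (N + 1) => (υ m' * cw δ X m') • (s • e)) + w) m = (c X m - ε + D + G) • e := by
    rw [Pi.add_apply, Pi.add_apply, hz, hw, Pi.single_eq_same, Pi.single_eq_same, smul_smul, ← add_smul, ← add_smul,
      cw_of_le δ hmX, hD]
    ring_nf
  rw [hlay, he, sum_norm_smul_single hk, abs_of_nonneg (by linarith [hc X m])] at hsum
  linarith

/-- THE ADMISSIBLE ONE-TABLE CLASS ON THE LAYERED WORD DOMAINS [bookkeeping]: for every index `Y` the table on encoded points is a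
real component (`cpart`, §8) of ONE function complex differentiable on the layered word domain of index `Y` — the reading (F-An) of
(2.41)(ii) p. 261 *"(ii) it has an extension to an analytic function on the space Ũ^c_j(X, α̃₀, α̃₁)"* (ANALOGY; CONTEXT only).
[cite: Balaban1988Convergent, (2.41) p.261] -/
def LwAdmT (k N : ℕ) (u : ℕ → ℕ → 𝔸) (r : ℕ → ℕ → ℝ) :
    (ℕ → ℝ) → BTable (lwCarriers 𝔸 k N) ((Fin (N + 1) → Fin k → 𝔸) × Fin 2) → Prop :=
  fun _ h => ∀ (Y : Fin (N + 1)) (a : Unit), ∃ hc : (Fin (N + 1) → Fin k → 𝔸) → ℂ,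
    DifferentiableOn ℂ hc (lwdom k N u r Y) ∧ ∀ w ∈ lwdom k N u r Y, ∀ i : Fin 2, h Y (w, i) a = cpart i (hc w)

/-- (F-An) for the layered word frame is the class's own wording. [folklore] -/
theorem lw_frameAnalytic (k N : ℕ) (υ : ℕ → ℝ) (δ : ℝ) (u : ℕ → ℕ → 𝔸) (r : ℕ → ℕ → ℝ) (W : Set (ℕ → ℝ)) :
    FrameAnalytic (lwFrame k N υ δ u r) W (LwAdmT k N u r) :=
  fun _ _ _ hh Y a _ => hh Y a

/-- The layer-`0` injection `A ↦ (A, 0, …, 0)` of one word into the layered words is real-linear. [folklore] -/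
theorem isLinearMap_single_layer (k N : ℕ) :
    IsLinearMap ℝ (fun A : Fin k → 𝔸 => (Pi.single (0 : Fin (N + 1)) A : Fin (N + 1) → Fin k → 𝔸)) := by
  constructor
  · intro A B
    funext m
    by_cases hm : m = 0
    · subst hm; simp
    · simp [Pi.single_eq_of_ne hm]
  · intro a A
    funext m
    by_cases hm : m = 0
    · subst hm; simp
    · simp [Pi.single_eq_of_ne hm]

/-! ### §(d) THE HOOK, LAYERED: (F-P) and `MarginCauchy` for the layered word encoding through its convex layered cores -/

section Hook

variable [CompleteSpace 𝔸] [NormOneClass 𝔸]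

/-- **THE LAYERED LETTER CORE OF THE CORE RADII LIES INSIDE THE LAYERED WORD DOMAIN** [folklore]: §13k's `wordCore_subset_wordDom`
LAYER BY LAYER — background letters `‖u_{m,i}‖ ≤ 1` whose words are within every radius, `‖u_{m,0}⋯u_{m,k−1} − 1‖ < r j m`. -/
theorem lwcore_subset_dom (k N : ℕ) (υ : ℕ → ℝ) (δ : ℝ) {u : ℕ → ℕ → 𝔸} (hu : ∀ m i, ‖u m i‖ ≤ 1) {r : ℕ → ℕ → ℝ}
    (hr : ∀ j m, ‖oprod (u m) k - 1‖ < r j m) (Y : Fin (N + 1)) :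
    lwcore 𝔸 k N (lcoreR u k r) Y ⊆ (lwFrame k N υ δ u r).dom Y :=
  fun A hA m hm => wordCore_subset_wordDom (u m) (hu m) k (hr Y m) ((mem_wcore_iff (A m)).1 (hA m hm))

/-- **(F-P) ON THE LAYERED WORD FRAME — `framePath_of_convexCore` APPLIED** [folklore]: the CHORD `z + t·disp` runs inside the convex
layered letter cores (`lwcore_convex`), which lie inside the layered word domains non-commutatively and layer by layer
(`lwcore_subset_dom`), and carries the two margins there (`lw_core_frameMargin`, `lw_core_frameEndMargin`) under the layered fit at
the core radii `lcoreR`. -/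
theorem lw_framePath (k N : ℕ) {υ : ℕ → ℝ} {δ : ℝ} {u : ℕ → ℕ → 𝔸} (hu : ∀ m i, ‖u m i‖ ≤ 1) {r : ℕ → ℕ → ℝ}
    (hr : ∀ j m, ‖oprod (u m) k - 1‖ < r j m) {c : ℕ → ℕ → ℝ} {s : ℝ} {gap : Fin (N + 1) → Fin (N + 1) → ℕ → ℝ}
    (hυ : ∀ m, 0 ≤ υ m) (hδ : 0 ≤ δ) (hs : 0 ≤ s) (hfit : LWordFits N c υ δ s gap (lcoreR u k r)) :
    FramePath (lwFrame k N υ δ u r) (lwGeneration 𝔸 k N) (lwChart 𝔸 k N c υ δ s) (lwGauge 𝔸 k N) gap :=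
  framePath_of_convexCore (d := lwcore 𝔸 k N (lcoreR u k r)) (lw_frameGauge k N υ δ u r c s)
    (fun Y => lwcore_subset_dom k N υ δ hu hr Y) (fun _ Y _ => lwcore_convex k N (lcoreR u k r) Y)
    (lw_core_frameMargin k N u r hυ hδ hs hfit) (lw_core_frameEndMargin k N u r hυ hδ hfit)

/-- **`MarginCauchy` (`c₀ = 2`) FOR TABLES ANALYTIC ON THE LAYERED WORD DOMAINS** [folklore]: `marginCauchy_of_convexCore` on the
layered word frame — (F-Ch)/(F-Co)/(F-G) by bookkeeping, the convex layered cores inside the layered word domains with their two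
margins from the layered fit, (F-An) the class's wording, positive rooms. -/
theorem lw_marginCauchy (k N : ℕ) {υ : ℕ → ℝ} {δ : ℝ} {u : ℕ → ℕ → 𝔸} (hu : ∀ m i, ‖u m i‖ ≤ 1) {r : ℕ → ℕ → ℝ}
    (hr : ∀ j m, ‖oprod (u m) k - 1‖ < r j m) {c : ℕ → ℕ → ℝ} {s : ℝ} {gap : Fin (N + 1) → Fin (N + 1) → ℕ → ℝ}
    (hυ : ∀ m, 0 ≤ υ m) (hδ : 0 ≤ δ) (hs : 0 ≤ s) (hg : ∀ X Y : Fin (N + 1), Y < X → ∀ j, 0 < gap X Y j)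
    (hfit : LWordFits N c υ δ s gap (lcoreR u k r)) (W : Set (ℕ → ℝ)) (κ : ℝ) :
    MarginCauchy (lwGeneration 𝔸 k N) (lwChart 𝔸 k N c υ δ s) W κ (LwAdmT k N u r) (lwGauge 𝔸 k N) gap 2 :=
  marginCauchy_of_convexCore (d := lwcore 𝔸 k N (lcoreR u k r)) (lw_frameChart k N υ δ u r c s)
    (lw_frameCore k N υ δ u r c s) (lw_frameGauge k N υ δ u r c s) (fun Y => lwcore_subset_dom k N υ δ hu hr Y)
    (fun _ Y _ => lwcore_convex k N (lcoreR u k r) Y) (lw_core_frameMargin k N u r hυ hδ hs hfit)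
    (lw_core_frameEndMargin k N u r hυ hδ hfit) (lw_frameAnalytic k N υ δ u r W)
    fun X Y hY j _ => hg X Y ((lw_mem_parents_iff X Y).mp hY) j

end Hook

/-! ### §(e) `CollarDecay` of the layered chart: the layer gauge of the displacement IS `υ n·δ^{X−n}·Σ‖𝒜_i‖` -/

/-- The layer gauge of the displaced layered word [folklore]: `dist n (chart X U 𝒜) U = Σ_i ‖(υ n·cw δ X n)·𝒜_i‖` (the layer `n`
read at `lay N n`). -/
theorem lw_dist_chart (k N : ℕ) (c : ℕ → ℕ → ℝ) (υ : ℕ → ℝ) (δ s : ℝ) (X : Fin (N + 1))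
    (U : (Fin (N + 1) → Fin k → 𝔸) × Fin 2) (𝒜 : Fin k → 𝔸) (n : ℕ) :
    (lwGauge 𝔸 k N).dist n ((lwChart 𝔸 k N c υ δ s).chart X U 𝒜) U =
      ∑ i, ‖((υ (lay N n) * cw δ X (lay N n)) • 𝒜) i‖ := by
  show ∑ i, ‖(U.1 (lay N n) + (υ (lay N n) * cw δ X (lay N n)) • 𝒜) i - U.1 (lay N n) i‖ = _
  simp

/-- **`CollarDecay` OF THE LAYERED CHART, NORMALIZED** [folklore]: in the gauge rescaled by layer units `ω > 0` dominating the chart's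
units, `υ m ≤ S·ω m`, the displacement of the step creating `X` read on an OLDER layer `n < X` has size `≤ S·s·δ^{X−n}` — §12's
`CollarDecay` with `ε = S·s` and rate `δ`, a theorem about the toy chart (print's sentence it is the toy face of: [III] p. 277 *"the
difference is very small and exponentially decreasing in the number of steps"*; CONTEXT only). [cite: Balaban1988Convergent, p.277] -/
theorem lw_collarDecay_rescale (k N : ℕ) (c : ℕ → ℕ → ℝ) {υ ω : ℕ → ℝ} {δ s S : ℝ} (hυ : ∀ m, 0 ≤ υ m) (hω : ∀ m, 0 < ω m)
    (hS : ∀ m, υ m ≤ S * ω m) (hδ : 0 ≤ δ) :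
    CollarDecay (lwChart 𝔸 k N c υ δ s) ((lwGauge 𝔸 k N).rescale ω hω) (S * s) δ := by
  intro X U _ 𝒜 h𝒜 n hn
  have hnX : n < (X : ℕ) := hn
  have hnN : n ≤ N := by have := X.is_lt; omega
  have h𝒜' : ∑ i, ‖𝒜 i‖ ≤ s := h𝒜
  have hsum0 : 0 ≤ ∑ i, ‖𝒜 i‖ := sum_nonneg fun i _ => norm_nonneg _
  rw [LayerGauge.rescale_dist, lw_dist_chart, lay_val_of_le hnN, sum_norm_layer_disp hυ hδ hnX.le, div_le_iff₀ (hω n)]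
  show υ n * δ ^ ((X : ℕ) - n) * ∑ i, ‖𝒜 i‖ ≤ S * s * δ ^ ((X : ℕ) - n) * ω n
  have hp : 0 ≤ δ ^ ((X : ℕ) - n) := pow_nonneg hδ _
  calc υ n * δ ^ ((X : ℕ) - n) * ∑ i, ‖𝒜 i‖ ≤ (S * ω n) * δ ^ ((X : ℕ) - n) * s :=
        mul_le_mul (mul_le_mul_of_nonneg_right (hS n) hp) h𝒜' hsum0
          (mul_nonneg (le_trans (hυ n) (hS n)) hp)
    _ = S * s * δ ^ ((X : ℕ) - n) * ω n := by ring

/-- `CollarDecay` OF THE LAYERED CHART, PLAIN [folklore]: with uniformly bounded units `υ m ≤ S` the un-normalized layer gauge decays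
with `ε = S·s` and rate `δ`. -/
theorem lw_collarDecay (k N : ℕ) (c : ℕ → ℕ → ℝ) {υ : ℕ → ℝ} {δ s S : ℝ} (hυ : ∀ m, 0 ≤ υ m) (hS : ∀ m, υ m ≤ S)
    (hδ : 0 ≤ δ) : CollarDecay (lwChart 𝔸 k N c υ δ s) (lwGauge 𝔸 k N) (S * s) δ := by
  intro X U _ 𝒜 h𝒜 n hn
  have hnX : n < (X : ℕ) := hn
  have hnN : n ≤ N := by have := X.is_lt; omega
  have h𝒜' : ∑ i, ‖𝒜 i‖ ≤ s := h𝒜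
  have hsum0 : 0 ≤ ∑ i, ‖𝒜 i‖ := sum_nonneg fun i _ => norm_nonneg _
  rw [lw_dist_chart, lay_val_of_le hnN, sum_norm_layer_disp hυ hδ hnX.le]
  show υ n * δ ^ ((X : ℕ) - n) * ∑ i, ‖𝒜 i‖ ≤ S * s * δ ^ ((X : ℕ) - n)
  have hp : 0 ≤ δ ^ ((X : ℕ) - n) := pow_nonneg hδ _
  calc υ n * δ ^ ((X : ℕ) - n) * ∑ i, ‖𝒜 i‖ ≤ S * δ ^ ((X : ℕ) - n) * s :=
        mul_le_mul (mul_le_mul_of_nonneg_right (hS n) hp) h𝒜' hsum0 (mul_nonneg (le_trans (hυ n) (hS n)) hp)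
    _ = S * s * δ ^ ((X : ℕ) - n) := by ring

/-- `CollarDecay` ON THE PRINTED UNITS IN COEFFICIENT UNITS [folklore]: gauge rescaled by `α`, `ε = a·s`, rate `δ`
(`lw_collarDecay_rescale` with `S = a`, `ω = α`). -/
theorem lwPrinted_collarDecay (k N : ℕ) (c : ℕ → ℕ → ℝ) {a δ s : ℝ} {α : ℕ → ℝ} (ha : 0 ≤ a) (hα : ∀ n, 0 < α n)
    (hδ : 0 ≤ δ) :
    CollarDecay (lwChart 𝔸 k N c (fun m => a * α m) δ s) ((lwGauge 𝔸 k N).rescale α hα) (a * s) δ :=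
  lw_collarDecay_rescale k N c (fun m => mul_nonneg ha (hα m).le) hα (fun _ => le_rfl) hδ

end LayeredFrame

end Summit.QuantumFields.BalabanUV.T4Continuum.BoundaryRateLayeredWord
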